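import Mathlib
import HarnessLib
import HarnessLib.Audit
import Summits.ABC.Statement
import Summits.ABC.ABC.Statement
import HarnessLib.Audit.Status.Attr

/-!
Route: NegOmegaAtlas

DORMANT since 2026-08-24T11:35:57Z (reconciler: no traction for 6.7 d (last activity item-evidence-added at 2026-08-17T17:07:42Z); parked, not closed — `ledger route dormant route-ABC-NegOmegaAtlas --off` to reactivate) — unstaffed, not closed; items shared with open routes are served there. `ledger route dormant <id> --off` reactivates.

# Route NegOmegaAtlas — ABC/ABC, negative side organised by the bounded-ω atlas (card
counterexample-atlas-bounded-omega)

## Thesis X (words)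
If abc fails with a bounded number of prime slots, the failure is visible as an infinite family:
there are k and δ > 0 and
infinitely many abc triples (a, b, c) with ω(abc) ≤ k and quality > 1 + δ. The atlas (this route's
certified part) says where
such a family can live: k ≥ 3 (the k ≤ 2 cell is closed, TwoSlotCell), and along the family either
(II-U) min(a,b) ≤ c^{1−η}
— an unbalanced "√-scale Pillai" coincidence, where linear forms in logarithms already force log c
≪_k (log rad)^k·log log c
(UnbalancedQuasiPolynomial) — or (II-B) min(a,b) > c^{1−η} for every η — a balanced "prime-Beal,
mixed exponents" family; in
both cells the largest prime is forced up, P(abc) ≥ (log c)^{1−o(1)} (PrimeFloorBoundedOmega).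
Regime (I), ω → ∞, is NOT this
route (all catalogued ε-witness families live there with quality → 1).
Lean: `∃ k : ℕ, ∃ δ : ℝ, 0 < δ ∧ {t : ℕ × ℕ × ℕ |
Literature.NumberTheory.DiophantineGeometry.IsABCTriple t.1 t.2.1 t.2.2 ∧ (t.1 * t.2.1 *
t.2.2).primeFactors.card ≤ k ∧ 1 + δ < Literature.NumberTheory.DiophantineGeometry.quality t.1 t.2.1
t.2.2}.Infinite`
(= the target item NegThesis; it and every other item elaborate with the Statement's imports only —
planner Sketch.lean rc 0.)

## Assembly X → ¬ABC (deciding theorem `closes`, certified native; the Assembly item NegThesis →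
¬ABC has a sorry-free proof attached as evidence on stmt-ABC-1232)
NegThesis gives an infinite set of triples of quality > 1 + δ, hence
Literature.NumberTheory.DiophantineGeometry.ABCNegation by
abcNegation_iff_infinite_quality_gt_holds; not_abcNegation_iff_forall_exists_const identifies
¬ABCNegation with the sentence of ABC.

## Two-layer plan (D-0019)
Layer 1 (now): target NegThesis, Assembly, three ranked cruxes = the atlas cells where X can hide
(UnbalancedFamily rank 2,
BalancedFamily rank 3, ThreeSlotFamily rank 4 = the first open rung), and four support statements
that are provable now and
certify the atlas walls: AtlasDichotomy (NegThesis ↔ U ∨ B, no fourth cell; proof attached on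
stmt-ABC-1228); UnbalancedQuasiPolynomial
and PrimeFloorBoundedOmega, each an implication whose hypothesis is the linear-forms input written
in abc language — the
archimedean bound log c − log a < K^{ω(bc)+1}·(∏_{p∣bc} log p)·log max(e, 2 log c), resp. the p-adic
bound
ν_p(c)·log p < K^{ω(ab)+1}·(∏_{q∣ab} log q)·(p/log p)·(log p + log max(e, 2 log c)) at the primes p
∣ c (ab > 1) — verbatim the
in-tree Pasten.arch_bound / Pasten.padic_bound_c at threshold N = 0 (theta_zero_eq), which hold at K
= pastenK under
Evertse–Győry Thm 4.2.1 over ℚ = Matveev + Yu (pasten2024_thm_2_1 from the named fact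
evertseGyory_thm_4_2_1_rat; planner
certificate Discharge.lean, rc 0, axioms std); TwoSlotCell, elementary. Cone hygiene (rev 3,
route-repair 2026-08-15): with the
hypotheses inlined and the largest prime factor replaced by an arbitrary bound P of the prime
factors of abc, the route file
imports only Summits.ABC.ABC.Statement — no named-fact debt of its own
(MultiplicativeGroupApproximation and
Barriers.ABC.BakerMethodBounds dropped); the hypotheses are discharged on the Literature side, never
inside the route.
Layer 2 (only after a crux closes): a REFUTED cell crux is a certified wall (negatives index) and
the route is repaired by
restating NegThesis's live cells (tenure: --restate / --drop); a PROVED cell crux closes NegThesis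
and ¬ABC via Assembly. Glue
for sub-cells (k = 3 balanced ⟹ prime Beal p^x+q^y=r^z in hyperbolic signature, Darmon–Granville per
signature; "mass at 2"
sub-cell of (II-U)) is deliberately not filed yet.

Rationale: WHY THIS LINE. ABC/ABC has no other negative-side route of this kind; D-0014 wants the negative side
staffed explicitly, and the
bounded-ω atlas (card ABC/ABC/counterexample-atlas-bounded-omega, graded new-combination twice) is
the sharpest available map of
where a counterexample family could live. Everything the route asserts positively is a corollary of
PROVED-shape results already
vendored in Literature (Evertse–Győry Thm 4.2.1 over ℚ = Matveev + Yu [EvertseGyory2015,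
Pasten2024]; S-unit finiteness
abc.S25 is a theorem in the tree; the k ≤ 2 cell needs only the parity cases of Catalan,
Gersonides), so provers can certify
the walls at once, while the three cruxes are genuine open statements whose settlement EITHER way is
information: proved ⟹
¬ABC; refuted ⟹ a new certified wall ("no bounded-ω counterexample in cell …"), recorded in the
negatives index. Imported
area: transcendence (linear forms in logarithms, archimedean and p-adic) used as WALLS, not as an
engine for ABC — and, since
rev 3, imported only as an explicit abc-language HYPOTHESIS of the two wall items (the N = 0
specialisations of Pasten's
Theorem 2.1, discharged on the Literature side by pasten2024_thm_2_1 from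
evertseGyory_thm_4_2_1_rat), so the route file's
import cone is the Statement's own and carries no named-fact debt; empirical input: de Weger's gap /
no-gap and real / p-adic
approximation-gain census [deWeger2026 §1, §5] matches the (U)/(B) split. Conjectural prediction
against all three cruxes:
Baker's ω-refinement max(|a|,|b|,|c|) ≪ N(log N)^ω/ω! [BakerWustholz2007 §3.7 p.52; Baker2004;
EvertseGyory2015 §4.6 p.87]
gives quality → 1 in every bounded-ω cell.

RANKED CRUXES (negative bets; each implies NegThesis; each expected to be hard to settle in either
polarity).
 2 UnbalancedFamily — cell (II-U): ∃k,η,δ>0, infinitely many ω ≤ k triples with min(a,b) ≤ c^{1−η}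
and quality > 1+δ
   ("√-scale Pillai"). Most constrained by proved walls (quasi-polynomial log c; P(abc) ≥ (log
c)^{1−o(1)}) and where de
   Weger's data put the record gains — hence the most informative cell; its negation is a uniform
Pillai-type finiteness.
 3 BalancedFamily — cell (II-B): ∃k,δ>0 ∀η>0, infinitely many ω ≤ k triples with min(a,b) > c^{1−η},
quality > 1+δ ("prime
   Beal with mixed exponents"); least constrained (only the prime floor and, per fixed signature,
Darmon–Granville).
 4 ThreeSlotFamily — first open rung: ∃δ>0, infinitely many ω(abc) ≤ 3 triples of quality > 1+δ (=
¬X₃ of card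
   omega-ladder-free-constants; contains uniform p^x ± q^y = r^z over all prime bases
[ScottStyer2004]).
SUPPORT (provable now; all four reviewed true by refuters fee09c2d / 8cafd4c0 and grounded by
g16-10). AtlasDichotomy (NegThesis ↔
U ∨ B: the "fourth cell" worry of the card is closed by logic; proof attached on stmt-ABC-1228);
UnbalancedQuasiPolynomial
(hypothesis: the archimedean bound log c − log a < K^{ω(bc)+1}(∏_{p∣bc} log p)·log max(e, 2 log c)
for all abc triples;
conclusion: log c ≤ C_{k,η}(log rad)^k·log max(e, 2 log c) in cell (II-U)); PrimeFloorBoundedOmega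
(hypothesis: the p-adic bound
ν_p(c) log p < K^{ω(ab)+1}(∏_{q∣ab} log q)(p/log p)(log p + log max(e, 2 log c)) at primes p ∣ c;
conclusion: log c ≤
C_k·P·(log P)^{k+1}·log max(e, 2 log c) whenever all primes of abc are ≤ P — the triage-4
correction: P(abc) ≥ (log c)^{1−o(1)},
not log log c, in BOTH cells, the unconditional bounded-ω case of Lagarias–Soundararajan's abc ⟹
P(abc) > (log c)^κ
[LagariasSoundararajan2011]); TwoSlotCell (k ≤ 2 ⟹ c < 2 rad, elementary). Both wall hypotheses are
verbatim
Pasten.arch_bound / Pasten.padic_bound_c at threshold N = 0 and hold at K = pastenK under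
Evertse–Győry 4.2.1 (planner
certificate Discharge.lean, rc 0); the Theorems files proving the walls must not import the Pasten
proof files (cone).
KILL CRITERIA. (a) ∀k NoBoundedOmegaViolators_k proved (e.g. X₃-template with e^{O(k)} constants,
card omega-ladder) refutes
NegThesis: close `refuted`. (b) All three cell cruxes refuted: close with census (the atlas is then
a theorem: bounded-ω abc).
(c) Baker's ω-refinement c ≪_k N(log N)^k proved for ω ≤ k also refutes all three. Partial kills are
repairs (restate live cells).
A refutation of a SUPPORT wall would contradict Matveev–Yu as vendored (Evertse–Győry 4.2.1) and is
not expected; it would be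
filed loudly as a Literature-level incident, not as a kill of this line.
NOT DECOMPOSED YET. Sub-cells (mass-at-2 in (II-U); k = 3 balanced ⟹ hyperbolic prime Beal via
darmon_granville; Kraus /
Darmon–Merel common-exponent exclusions), kit censuses (prime-Beal meet-in-the-middle, Pillai tables
with Lean-checkable
witnesses) — filed as --supports lemmas / evidence by provers and refuters, or as splits after a
crux moves. The Literature-side
discharge of the two wall hypotheses (one-line corollaries of pasten2024_thm_2_1 + theta_zero_eq) is
deliberately not a route item.
CHEAPEST FALSIFIER. No finite computation refutes an "infinitely many" cell, so the cheapest KILL is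
a theorem: X₃ (three-slot
abc — ∀δ>0 only finitely many ω(abc) ≤ 3 triples of quality > 1+δ, card omega-ladder-free-constants)
refutes ThreeSlotFamily
outright and is the template for the other cells. The cheapest EVIDENCE check has been run (refuter
census attached on
stmt-ABC-1227): the complete list of ω(abc) ≤ 3 triples with quality > 1 and c ≤ 10⁹ has 19 entries,
champion 3 + 5³ = 2⁷
(q = 1.4266), none with c > 2¹⁷; next cheapest: the ω(abc) ≤ 4, 5 sub-census with quality > 1.2
extracted from the complete
table of abc triples below 2⁶³ [deWeger2026 = arXiv:2602.08051] — a record quality that stops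
growing with c in every cell is the
expected, line-weakening outcome; a growing one would promote the corresponding cell crux.

Novelty: NOVELTY (search-before-claim, 2026-08-15, this planner; plus the two refuter audits recorded on the
card). Searches run:
`lit search --hybrid "abc conjecture triples with bounded number of prime factors omega(abc) Pillai
prime powers"` (held books:
BakerWustholz2007 p.52, EvertseGyory2015 pp.87-88 READ), `lit search --hybrid "smooth abc triples
largest prime factor ... Lagarias
Soundararajan"`, `lit frontier ABC --since 2020` (30 rows; arXiv:2606.08416 alternative quality
metrics, nothing on bounded ω),
`lit bridges ABC --cross any`, `lit read arxiv:2602.08051` (pp.3, 9 READ), crossref "Pillai equation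
prime powers" / Scott–Styer
(doi:10.1016/j.jnt.2003.11.008 located, bib added); `lit galaxy search --star all|pdf` twice:
galaxyd saturated (>90 s), OpenAlex /
arXiv / S2 rate-limited this session — the card's triage-4 and novelty-audit-13 ran the
galaxy/crossref sweeps ("abc conjecture
bounded number of prime factors", "three term exponential Diophantine prime bases",
generalized-Fermat surveys) with the same outcome.
Nearest prior art FOUND: (1) the ω-stratified shape of abc is Baker's refinement max(|a|,|b|,|c|) ≪
N(log N)^ω/ω! with explicit
constant 6/5 [BakerWustholz2007 §3.7 p.52; Baker1998; Baker2004; EvertseGyory2015 §4.6 p.87] — a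
CONJECTURE predicting quality → 1
in every bounded-ω cell, i.e. the negation-in-spirit of all three cruxes; effective ω-dependent
bounds c < exp(2^{10t+22}t^{4−t}
Q(log Q)^t), t = ω(abc) [Gyory2008, EvertseGyory2015 (4.6.4)] and Stewart–Yu [S  [refs: 10.1016/j.jnt.2003.11.008, 2606.08416, 2602.08051, 2206.14067, arxiv:2602.08051, doi:10.1016/j.jnt.2003.11.008, BakerWustholz2007, EvertseGyory2015, Baker1998, Baker2004, Gyory2008, StewartYu2001, Pasten2024, LagariasSoundararajan2011, ScottStyer2004, Mihailescu2004]

Barriers (technique_class: neg-route bounded-omega-abc atlas baker-method): Literature.Barriers.ABC.BakerMethodBounds: used as a WALL, never as an engine towards ABC —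
UnbalancedQuasiPolynomial and PrimeFloorBoundedOmega are corollaries of the proved-shape estimates
(PastenApproximationBound = Evertse–Győry 4.2.1 over ℚ) in the bounded-ω sub-regime, where ∏ log p ≤
(log rad)^k is polylogarithmic, consistent with the barrier (which blocks polynomial-in-rad bounds
for ALL triples); the cruxes assert nothing a Baker-type bound could prove or refute today (that is
exactly why they are cruxes: Yu's p^{O(1)} loss leaves √-scale Pillai and prime Beal open).
Literature.Barriers.ABC.BakerShapeConstantFloor: Baker's refinement c < κN(log N)^ω/ω! is cited only
as the CONJECTURAL prediction against the cruxes; no item asserts it, and the floor κ > 1.1997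
concerns its explicit constant, irrelevant to the ∃δ/finiteness form of every item here.
Literature.Barriers.ABC.EpsilonCannotBeDropped: all Stewart–Tijdeman / van Frankenhuijsen / Bright
witness families have ω(abc) → ∞ and quality → 1 (regime (I)), so they neither prove NegThesis
(which needs quality > 1+δ at bounded ω) nor meet any support item; the route asserts no ε-free
inequality.
Literature.Barriers.ABC.ExplicitABCQualityFloor: Reyssat's triple (ω = 4, quality 1.6299) is one
point in cell (II-U) at small scale; NegThesis needs infinitely many, and no support item claims an
exception-free inequality with constant 1.
Literature.Barriers.ABC.TijdemanZagierNeedsExponentThree: consistent — the ten known copri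

History (route lifecycle, newest last):
- 2026-08-15T16:18:34Z · rev 3: restated UnbalancedQuasiPolynomial (stmt-ABC-1229), PrimeFloorBoundedOmega (stmt-ABC-1230) — route-repair (cone guardrail, unit rrepair-ABC-NegOmegaAtlas-ebd4c193-g2): rerouted — imports cut to Summits.ABC.ABC.Statement (dropped Literature.NumberTheory. (planner-rrepair-ABC-NegOmegaAtlas-ebd4c193-g2-0)
- 2026-08-16T03:41:19Z · AUTO-CRUX (backfill): NegThesis — hypotheses of the deciding theorem that nothing in the route derives are cruxes (operator:999:586464)
- 2026-08-24T11:35:57Z · DORMANT — reconciler: no traction for 6.7 d (last activity item-evidence-added at 2026-08-17T17:07:42Z); parked, not closed — `ledger route dormant route-ABC-NegOmegaAtla (operator:999:2847777)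

sub-problem: ABC · status: dormant · opened planner-plancard-ABC-ABC-counterexample-atlas-42bd0ade-0 2026-08-15T10:53:52Z · rev 3 · ledger route-ABC-NegOmegaAtlas
GENERATED by the gate from the ledger (D-0016/17). Provers cite these decls: `theorem foo : Summit.ABC.ABC.Theses.NegOmegaAtlas.<Decl> := …` in Summits/ABC/ABC/Theorems/<Name>.lean.
-/

namespace Summit.ABC.ABC.Theses.NegOmegaAtlas

open scoped BigOperators Topology Manifold Classical MeasureTheory ProbabilityTheory Matrix InnerProductSpace ComplexConjugate ContinuousMap
open Filter Set Function TopologicalSpace MeasureTheory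

attribute [summit_statement] _root_.ABC

open Literature.Abc

/-- item stmt-ABC-1224 · crux (kind.auto-crux: conjecture-grade) · rank 0 · open · by planner
why it might fail: False if ABC holds, and already if Baker's refinement c << N(log N)^omega/omega! (explicit constant 6/5, consistent with the 2.4e7 known triples below 2^63) holds at bounded omega: quality -> 1 in every bounded-omega cell; catalogued eps-witness families (Stewart–Tijdeman, Bright) have omega -> oo.
sources: BakerWustholz2007 §3.7 (PDF p.52, read), EvertseGyory2015 §4.6 pp.87-88 (read); Baker2004; arXiv:1112.2461, deWeger2026 = arXiv:2602.08051 §5 p.9 (read), Literature.Barriers.ABC.EpsilonCannotBeDropped (witness families, omega unbounded), Literature.NumberTheory.DiophantineGeometry.ABCNegation (abc.S02 docstring: open on both sides)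
[target] X, the negative side of ABC inside the bounded-omega atlas: some k and delta > 0 admit
infinitely many abc triples with omega(abc) <= k and quality > 1 + delta. Equivalent to the failure
of `forall k, NoBoundedOmegaViolators k` (card counterexample-atlas-bounded-omega, item (4) of 'What
it needs'); k <= 2 is excluded by TwoSlotCell, so X lives at k >= 3, and by AtlasDichotomy in cell
(II-U) or (II-B). Elaborates (planner Sketch.lean rc 0). -/
@[route_item "route-ABC-NegOmegaAtlas", crux]
def NegThesis : Prop :=
  ∃ k : ℕ, ∃ δ : ℝ, 0 < δ ∧ {t : ℕ × ℕ × ℕ | Literature.NumberTheory.DiophantineGeometry.IsABCTriple t.1 t.2.1 t.2.2 ∧ (t.1 * t.2.1 * t.2.2).primeFactors.card ≤ k ∧ 1 + δ < Literature.NumberTheory.DiophantineGeometry.quality t.1 t.2.1 t.2.2}.Infinite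

/-- item stmt-ABC-1225 · crux · rank 2 · open · by planner
why it might fail: Likely FALSE: ABC, and already Baker's explicit refinement c < 6/(5t!)·N(log N)^t, t=omega(abc) (consistent with all ~2.4e7 known triples), force quality -> 1 at bounded omega; the proved (II-U) wall log c <<_k (log rad)^k·loglog c leaves only sqrt-scale Pillai coincidences; census shows no family.
sources: BakerWustholz2007 §3.7 (PDF p.52, read): max(|a|,|b|,|c|) << N(log N)^omega/omega!, constant 6/5, EvertseGyory2015 §4.6 pp.87-88 (read): Baker 2004 explicit form; Gyory 2008a (4.6.4), arXiv:1112.2461 (Laishram–Shorey 2012, Baker's explicit abc-conjecture), Pasten2024 Thm 1.4(1) = Literature.Barriers.ABC.pasten2024_thm_1_4_1; in-tree Pasten.arch_bound + theta_zero_eq, deWeger2026 = arXiv:2602.08051 §1 p.3, §5 p.9 (read: 14 482 065 + 9 345 651 abc-triples below 2^63), ScottStyer2004 = doi:10.1016/j.jnt.2003.11.008 (p^x - q^y = c, prime bases: count not size)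
[crux] Cell (II-U) of the atlas is inhabited: for some k, eta > 0, delta > 0 there are infinitely
many abc triples with omega(abc) <= k, min(a,b) <= c^(1-eta) and quality > 1 + delta — an infinite
'sqrt-scale Pillai' family (a tiny term against two near-equal products of few prime powers).
Implies NegThesis (drop the balance clause). Any such family obeys the certified walls
UnbalancedQuasiPolynomial (log c <<_k (log rad)^k loglog c) and PrimeFloorBoundedOmega (P(abc) >=
(log c)^(1-o(1))), so its primes sit at scale exp((log c)^(1/k - o(1))), beyond the two-logarithm
Laurent–Mignotte–Nesterenko range. Settling it either way is the most informative event for the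
atlas: a proof is ¬ABC, a refutation is uniform Pillai-type finiteness at bounded omega (a new wall,
recorded in the negatives index). -/
@[route_item "route-ABC-NegOmegaAtlas", crux]
def UnbalancedFamily : Prop :=
  ∃ k : ℕ, ∃ η : ℝ, 0 < η ∧ ∃ δ : ℝ, 0 < δ ∧ {t : ℕ × ℕ × ℕ | Literature.NumberTheory.DiophantineGeometry.IsABCTriple t.1 t.2.1 t.2.2 ∧ (t.1 * t.2.1 * t.2.2).primeFactors.card ≤ k ∧ ((min t.1 t.2.1 : ℕ) : ℝ) ≤ (t.2.2 : ℝ) ^ (1 - η) ∧ 1 + δ < Literature.NumberTheory.DiophantineGeometry.quality t.1 t.2.1 t.2.2}.Infinite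

/-- item stmt-ABC-1226 · crux · rank 3 · open · by planner
why it might fail: Likely FALSE: ABC / Baker's omega-refinement predict quality -> 1 in every bounded-omega cell; at k=3 it is prime Beal p^x+q^y=r^z with unbounded mixed signatures: each fixed hyperbolic signature is finite (Darmon–Granville), the 10 known Fermat–Catalan solutions have q <= 1.23, Beal searches: none.
sources: DarmonGranville1995 Thm 2 = Literature.NumberTheory.DiophantineGeometry.darmon_granville, Literature.Barriers.ABC.TijdemanZagierNeedsExponentThree (knownFermatCatalan, card = 10), BakerWustholz2007 §3.7 p.52 (read); EvertseGyory2015 §4.6 p.87 (read), deWeger2026 = arXiv:2602.08051 §1 p.3 (read: no-gap triples, p-adic approximation gain), arXiv:2206.14067 (Scott–Styer: <= 2 solutions of a^x+b^y=c^z) and doi:10.3336/gm.59.2.02 (Styer 2024: <= 1) — count per base triple, no size bound, Nitaj1996 (tables of good abc examples)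
[crux] Cell (II-B) of the atlas is inhabited: for some k and delta > 0 and EVERY eta > 0 there are
infinitely many abc triples with omega(abc) <= k, min(a,b) > c^(1-eta) and quality > 1 + delta — a
balanced 'prime Beal with mixed exponents' family. Implies NegThesis. At k = 3 such a family
consists of three prime powers p^x + q^y = r^z in hyperbolic signature (1/x+1/y+1/z <=
1/((1-eta)(1+delta)) < 1), so by Darmon–Granville (named fact
Literature.NumberTheory.DiophantineGeometry.darmon_granville, per fixed signature) its signatures
escape every finite set; common-exponent sub-families are excluded by modularity (Wiles,
Darmon–Merel, Kraus) — the surviving shape is genuinely mixed/unbounded signatures. No linear form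
in logarithms is small here; the only certified wall is the prime floor PrimeFloorBoundedOmega
(p-adic, Yu) — the triage-4 correction to the card. -/
@[route_item "route-ABC-NegOmegaAtlas", crux]
def BalancedFamily : Prop :=
  ∃ k : ℕ, ∃ δ : ℝ, 0 < δ ∧ ∀ η : ℝ, 0 < η → {t : ℕ × ℕ × ℕ | Literature.NumberTheory.DiophantineGeometry.IsABCTriple t.1 t.2.1 t.2.2 ∧ (t.1 * t.2.1 * t.2.2).primeFactors.card ≤ k ∧ (t.2.2 : ℝ) ^ (1 - η) < ((min t.1 t.2.1 : ℕ) : ℝ) ∧ 1 + δ < Literature.NumberTheory.DiophantineGeometry.quality t.1 t.2.1 t.2.2}.Infinite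

/-- item stmt-ABC-1227 · crux · rank 4 · open · by planner
why it might fail: Likely FALSE (= ¬X_3): Baker's explicit conjecture at t=3 reads c < N(log N)^3/5, so quality -> 1; known omega=3 examples are small (3+5^3=2^7: q=1.4266; no known triple beats Reyssat's 1.6299, omega=4); Scott–Styer/Styer bound only the NUMBER of solutions per base triple, Gyory (4.6.4) is exp in Q.
sources: ScottStyer2004 = doi:10.1016/j.jnt.2003.11.008, arXiv:2206.14067 p.1 (read: at most two solutions to a^x+b^y=c^z); doi:10.3336/gm.59.2.02 (Styer 2024), EvertseGyory2015 §4.6 p.87 (read: c < 6/(5t!)Q(log Q)^t) and (4.6.4) p.88 (read: Gyory 2008a), Literature.Barriers.ABC.BakerMethodBounds (docstring: p-adic loss, omega-dependent explicit bounds), Literature.Barriers.ABC.ExplicitABCQualityFloor (reyssat_quality_gt: 1.6299, omega = 4), Mihailescu2004 (k = 2 closed; TwoSlotCell needs only parity cases)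
[crux] The first open rung carries a violating family: for some delta > 0, infinitely many abc
triples with omega(abc) <= 3 and quality > 1 + delta. Implies NegThesis (k = 3); k <= 2 is closed by
TwoSlotCell. omega(abc) <= 3 means {1, p^x q^y, r^z}-type (then automatically unbalanced, cell II-U)
or three prime powers p^x + q^y = r^z (cell II-B when balanced). This is the negation of X_3 =
'three-slot abc' of card omega-ladder-free-constants and contains the negation of P3 of card
three-prime-powers-padic-exponent; if a route files X_3 / P3 positively, a proof there closes this
item as refuted (certified wall 'no bounded-omega counterexample at k = 3') and the tenure planner
drops or restates it — intended dynamics, not churn. -/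
@[route_item "route-ABC-NegOmegaAtlas", crux]
def ThreeSlotFamily : Prop :=
  ∃ δ : ℝ, 0 < δ ∧ {t : ℕ × ℕ × ℕ | Literature.NumberTheory.DiophantineGeometry.IsABCTriple t.1 t.2.1 t.2.2 ∧ (t.1 * t.2.1 * t.2.2).primeFactors.card ≤ 3 ∧ 1 + δ < Literature.NumberTheory.DiophantineGeometry.quality t.1 t.2.1 t.2.2}.Infinite

/-- item stmt-ABC-1228 · support · rank 5 · closed · proved by Summit.ABC.ABC.Theorems.atlasDichotomy_proof @ dcfd43a19dfc (prover) · by planner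
[support] The atlas has no fourth cell at bounded omega: NegThesis <-> (UnbalancedFamily ∨
BalancedFamily). Pure logic (fix k, delta; either some eta > 0 gives an infinite unbalanced part, or
for every eta the unbalanced part is finite and its complement in the infinite violating set is
infinite; converses drop a clause / take eta = 1). PROVABLE NOW: 20-line script checked in the
planner's Sketch.lean (rc 0). Answers the card's 'fastest refutation: a fourth cell' worry formally. -/
@[route_item "route-ABC-NegOmegaAtlas", crux]
def AtlasDichotomy : Prop :=
  NegThesis ↔ (UnbalancedFamily ∨ BalancedFamily)

-- earlier UnbalancedQuasiPolynomial (stmt-ABC-1229, replaced 2026-08-15T16:18:34Z -> stmt-ABC-10558): retired by None — ∀ K : ℝ, 1 ≤ K → Literature.NumberTheory.DiophantineGeometry.Dioph.PastenApproximationBound K → ∀ k : ℕ, ∀ η : ℝ, 0 < η → ∃ C : ℝ, ∀ a b c : ℕ, Literature.NumberTheory.DiophantineGeometry.IsABCTriple a b c → (a * b * c).primeFactors.card ≤ k → ((min a b : ℕ) : ℝ) ≤ (c : ℝ) ^ (1 - η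
/-- item stmt-ABC-10558 · support · rank 6 · open · by planner
[support] Certified (II-U) wall — quasi-polynomial abc in the unbalanced bounded-omega cell, stated
over the Statement's imports only (rev-3 cone repair; supersedes stmt-ABC-1229, same content with
the hypothesis PastenApproximationBound K specialised to what is used): for every K >= 1, IF every
abc triple satisfies the archimedean linear-forms bound log c - log a < K^(omega(bc)+1) * (prod_{p |
bc} log p) * log max(e, 2 log c) (verbatim Pasten.arch_bound at threshold N = 0 via theta_zero_eq —
PastenSubexpPlaces.lean:145, BakerMethodBoundsThreeRoutesProofs.lean:268 — holding at K = pastenK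
under evertseGyory_thm_4_2_1_rat = Matveev+Yu over Q by pasten2024_thm_2_1; planner certificate
Discharge.lean rc 0), THEN for all k and eta > 0 there is C with log c <= C * (log rad)^k * log
max(e, 2 log c) whenever omega(abc) <= k and min(a,b) <= c^(1-eta). PROVABLE NOW, elementary given
the hypothesis (est. 50-100 lines): WLOG a = min (else apply the hypothesis to the swapped triple
(b,a,c): IsABCTriple.swap, rad_swap); log a <= (1-eta) log c gives eta * log c <= log c - log a <
K^(omega(bc)+1) * (prod log p) * Y, Y = log max(e, 2 log c) >= 1; each log p <= log rad and log rad
>= 1 once rad >= -/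
@[route_item "route-ABC-NegOmegaAtlas", crux]
def UnbalancedQuasiPolynomial : Prop :=
  ∀ K : ℝ, 1 ≤ K → (∀ a b c : ℕ, Literature.NumberTheory.DiophantineGeometry.IsABCTriple a b c → Real.log c - Real.log a < K ^ ((b * c).primeFactors.card + 1) * (∏ p ∈ (b * c).primeFactors, Real.log p) * Real.log (max (Real.exp 1) (2 * Real.log c))) → ∀ k : ℕ, ∀ η : ℝ, 0 < η → ∃ C : ℝ, ∀ a b c : ℕ, Literature.NumberTheory.DiophantineGeometry.IsABCTriple a b c → (a * b * c).primeFactors.card ≤ k → ((min a b : ℕ) : ℝ) ≤ (c : ℝ) ^ (1 - η) → Real.log c ≤ C * Real.log (Literature.NumberTheory.DiophantineGeometry.rad a b c : ℕ) ^ k * Real.log (max (Real.exp 1) (2 * Real.log c))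

-- earlier PrimeFloorBoundedOmega (stmt-ABC-1230, replaced 2026-08-15T16:18:34Z -> stmt-ABC-10559): retired by None — ∀ K : ℝ, 1 ≤ K → Literature.NumberTheory.DiophantineGeometry.Dioph.PastenApproximationBound K → ∀ k : ℕ, ∃ C : ℝ, ∀ a b c : ℕ, Literature.NumberTheory.DiophantineGeometry.IsABCTriple a b c → (a * b * c).primeFactors.card ≤ k → Real.log c ≤ C * (Literature.Barriers.ABC.largestPrimeFact
/-- item stmt-ABC-10559 · support · rank 7 · open · by planner
[support] Certified prime floor in BOTH bounded-omega cells (triage-4 correction of the card's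
(B)-wall), stated over the Statement's imports only (rev-3 cone repair; supersedes stmt-ABC-1230:
hypothesis PastenApproximationBound K specialised to what is used,
Literature.Barriers.ABC.largestPrimeFactor replaced by an arbitrary bound P of the prime factors):
for every K >= 1, IF every abc triple with ab > 1 satisfies at every prime p | c the p-adic
linear-forms bound nu_p(c) * log p < K^(omega(ab)+1) * (prod_{q | ab} log q) * (p / log p) * (log p
+ log max(e, 2 log c)) (verbatim Pasten.padic_bound_c at threshold N = 0 via theta_zero_eq —
PastenSubexpPlaces.lean:221 — holding at K = pastenK under evertseGyory_thm_4_2_1_rat by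
pasten2024_thm_2_1; planner certificate Discharge.lean rc 0), THEN for every k there is C such that
every abc triple with omega(abc) <= k whose prime factors are all <= P satisfies log c <= C * P *
(log P)^(k+1) * log max(e, 2 log c). With P = P(abc) this is P(abc) >= (log c)^(1-o(1)) along any
bounded-omega family — the unconditional bounded-omega case of Lagarias–Soundararajan's conditional
'abc => finitely many triples with P(abc) <= (log c)^kappa, kappa < 1' -/
@[route_item "route-ABC-NegOmegaAtlas", crux]
def PrimeFloorBoundedOmega : Prop :=
  ∀ K : ℝ, 1 ≤ K → (∀ a b c : ℕ, Literature.NumberTheory.DiophantineGeometry.IsABCTriple a b c → 1 < a * b → ∀ p : ℕ, p.Prime → p ∣ c → (c.factorization p : ℝ) * Real.log p < K ^ ((a * b).primeFactors.card + 1) * (∏ q ∈ (a * b).primeFactors, Real.log q) * ((p / Real.log p) * (Real.log p + Real.log (max (Real.exp 1) (2 * Real.log c))))) → ∀ k : ℕ, ∃ C : ℝ, ∀ a b c : ℕ, Literature.NumberTheory.DiophantineGeometry.IsABCTriple a b c → (a * b * c).primeFactors.card ≤ k → ∀ P : ℕ, (∀ p ∈ (a * b * c).primeFactors, p ≤ P)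 → Real.log c ≤ C * P * Real.log P ^ (k + 1) * Real.log (max (Real.exp 1) (2 * Real.log c))

/-- item stmt-ABC-1231 · support · rank 8 · closed · proved by Summit.ABC.ABC.Theorems.twoSlotCell_proof @ a115fed52956 (prover) · by planner
[support] The k <= 2 cell is closed, epsilon-free and unconditionally: omega(abc) <= 2 forces {a,b}
∋ 1, say a = 1, b = p^x, c = q^y consecutive, so one of p, q is 2; the parity cases of Catalan (q^y
- 2^x = 1 => (8,9) or y = 1; 2^y - p^x = 1 => x = 1; Gersonides/Levi ben Gerson, elementary
factorisations of q^y - 1 and p^x + 1) give the full list {(1,1,2), (1,2^x, Fermat prime), (1,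
Mersenne prime, 2^y), (1,2,3), (1,8,9)} up to swapping a,b, all with c <= rad except (1,8,9): c = 9,
rad = 6. Hence c < 2 rad(abc) (even 2c <= 3 rad). Mihailescu's full theorem (named fact
Literature.NumberTheory.DiophantineGeometry.mihailescu) is NOT needed; a prover who prefers may cite
the in-tree Catalan files (CatalanLebesgue/KoChao/Euler) for sub-cases. PROVABLE NOW (est. 150-250
lines, mostly Nat case analysis). Consequence: NegThesis needs k >= 3 (ThreeSlotFamily is the first
rung). Sources: Mihailescu2004; card omega-ladder-free-constants (rung X_2). -/
@[route_item "route-ABC-NegOmegaAtlas", crux]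
def TwoSlotCell : Prop :=
  ∀ a b c : ℕ, Literature.NumberTheory.DiophantineGeometry.IsABCTriple a b c → (a * b * c).primeFactors.card ≤ 2 → c < 2 * Literature.NumberTheory.DiophantineGeometry.rad a b c

/-- item stmt-ABC-1232 · assembly · rank 1 · closed · proved by Summit.ABC.ABC.Theorems.negOmegaAtlasAssembly_proof @ dcfd43a19dfc (prover) · by planner
[assembly] NegThesis -> ¬ABC. PROVABLE NOW (8-line script checked in the planner's Sketch.lean,
axioms propext/Classical.choice/Quot.sound): the infinite set of NegThesis is contained in {t |
IsABCTriple ∧ 1 + delta < quality}, so Literature.NumberTheory.DiophantineGeometry.ABCNegation holds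
by abcNegation_iff_infinite_quality_gt_holds (unfold the def abcNegation_iff_infinite_quality_gt
first), and not_abcNegation_iff_forall_exists_const.mpr turns the hypothesis ABC (definitionally the
forall-eps-exists-C sentence) into ¬ABCNegation. Imports:
Literature.NumberTheory.DiophantineGeometry.AbcWave0QualityFormProofs + Summits.ABC.ABC.Statement. -/
@[route_item "route-ABC-NegOmegaAtlas", crux]
def Assembly : Prop :=
  NegThesis → ¬ ABC

/-! D-0027 §2.1 — DECIDING THEOREM (planner-authored via `route open/edit --closes-file`; by operator:999:377415 2026-08-15T14:35:07Z):
its hypotheses are this route's items and its conclusion the sub-problem Statement (glue_lint), and it elaborates with this file. -/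

@[closes "route-ABC-NegOmegaAtlas"] theorem closes : NegThesis → UnbalancedFamily → BalancedFamily → ThreeSlotFamily → AtlasDichotomy → UnbalancedQuasiPolynomial → PrimeFloorBoundedOmega → TwoSlotCell → Assembly → ¬ _root_.ABC := fun h_NegThesis h_UnbalancedFamily h_BalancedFamily h_ThreeSlotFamily h_AtlasDichotomy h_UnbalancedQuasiPolynomial h_PrimeFloorBoundedOmega h_TwoSlotCell h_Assembly => h_Assembly h_NegThesis

end Summit.ABC.ABC.Theses.NegOmegaAtlas
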